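import Summits.AtomisticToContinuum.HydrodynamicLimit.Theorems.LambertianContactSwapSwapGapGibbsDomination
import Summits.AtomisticToContinuum.HydrodynamicLimit.Theorems.LambertianContactSwapSwapGapDominatedKL
import Summits.AtomisticToContinuum.HydrodynamicLimit.Theorems.RelayRaceLocalityNearConstantShortTimeHLMeansPin
import HarnessLib

/-!
# `SwapGap` (stmt-AtomisticToContinuum-11850), line `Sketch`, stub `stub_staticBookkeeping` — part I: the entropy gap against an energy-law-preserving competitor

Helper file (`--supports stmt-AtomisticToContinuum-11850`) for the registered stub `stub_staticBookkeeping` of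
the crux `Summit.AtomisticToContinuum.HydrodynamicLimit.Theses.LambertianContactSwap.SwapGap` (file
`…SwapGapStubStaticBookkeeping.lean`). Pure statics of local Gibbs laws of `N + 1` hard spheres at reduced
diameter `σ ≤ 1/2` (`P = localGibbsLaw σ a u θ`, `ψ = localGibbsLaw σ b w ϑ`, `G = localGibbsLaw σ 1 0 1`):

* `toReal_klDiv_sub_le_of_dominated` — the abstract chain-rule estimate: for probability laws `P, ψ, G, μ` with
  `G e^{-V} ≤ ψ ≤ G e^{V}`, `KL(μ ‖ G) ≤ KL(P ‖ G) < ∞`, log-likelihoods `llr P G = L_P − L_G`, `llr ψ G = L_ψ − L_G`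
  a.s. and `∫ L_G dμ = ∫ L_G dP`: `0 ≤ KL(P ‖ G) − KL(μ ‖ G) ≤ ∫ L_P dP − ∫ L_ψ dμ` (`KL(μ ‖ ψ) ≥ 0`);
* `toReal_klDiv_sub_le` — its hard-sphere instance: if `μ` has no less entropy than `P` relative to `G` and the SAME LAW
  OF THE KINETIC ENERGY as `P`, then
  `0 ≤ KL(P ‖ G) − KL(μ ‖ G) ≤ (N+1) (E_P⟨emp, log p⟩ − E_μ⟨emp, log q⟩) − log Z(p) + log Z(q)`
  (`p, q` the one-body profiles of `P, ψ`; the `G`-terms cancel because `log g` is an affine function of the energy);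
* transfer lemmas along an equality of image laws (`integral_comp_eq_of_map_eq`, `lintegral_comp_eq_of_map_eq`);
* `integral_logProfile_sub_pressure_eq` — the thermodynamic identity `m − π = −S − (3/2 log 2π + 3/2)·mass` relating the
  matched log-profile mean, the pressure per particle and the thermodynamic entropy of a profile.

References: H.-T. Yau, Lett. Math. Phys. 22 (1991) §2; C. Kipnis – C. Landim (1999), Ch. 6 §1, App. 1 §8.
-/

noncomputable section

open MeasureTheory Filter Set Topology InformationTheory
open scoped ENNReal

namespace Summit.AtomisticToContinuum.HydrodynamicLimit.Theorems.SwapGapStaticBookkeeping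

open Literature.Analysis.FluidPDE Literature.MathematicalPhysics.KineticTheory
open Summit.AtomisticToContinuum.HydrodynamicLimit.Theorems.LambertianContactSwapSwapGapGibbsDomination
open Summit.AtomisticToContinuum.HydrodynamicLimit.Theorems.LambertianContactSwapSwapGapDominatedKL
open Summit.AtomisticToContinuum.HydrodynamicLimit.Theorems.NearConstantShortTimeHL

/-! ## Transfer along an equality of image laws -/

/-- Integrability and the integral of a continuous function of a statistic depend only on the law of the
statistic. [folklore] -/
theorem integral_comp_eq_of_map_eq {α : Type*} [MeasurableSpace α] {μ ν : Measure α} {E : α → ℝ}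
    (hE : Measurable E) (hmap : μ.map E = ν.map E) {F : ℝ → ℝ} (hF : Continuous F)
    (hi : Integrable (fun z => F (E z)) ν) :
    Integrable (fun z => F (E z)) μ ∧ ∫ z, F (E z) ∂μ = ∫ z, F (E z) ∂ν := by
  have h1 : Integrable F (ν.map E) :=
    (integrable_map_measure hF.aestronglyMeasurable hE.aemeasurable).2 hi
  rw [← hmap] at h1
  refine ⟨(integrable_map_measure hF.aestronglyMeasurable hE.aemeasurable).1 h1, ?_⟩
  rw [← integral_map hE.aemeasurable hF.aestronglyMeasurable,
    ← integral_map hE.aemeasurable hF.aestronglyMeasurable, hmap]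

/-- The lower integral of a measurable function of a statistic depends only on the law of the statistic.
[folklore] -/
theorem lintegral_comp_eq_of_map_eq {α : Type*} [MeasurableSpace α] {μ ν : Measure α} {E : α → ℝ}
    (hE : Measurable E) (hmap : μ.map E = ν.map E) {F : ℝ → ℝ≥0∞} (hF : Measurable F) :
    ∫⁻ z, F (E z) ∂μ = ∫⁻ z, F (E z) ∂ν := by
  rw [← lintegral_map hF hE, ← lintegral_map hF hE, hmap]

/-! ## The log-profile of the standard homogeneous Gibbs law -/

/-- `log (localGibbsProfile 1 0 1 (x, v)) = −(3/2) log(2π) − ‖v‖²/2`. [folklore] -/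
theorem log_localGibbsProfile_one (y : T3 × V3) :
    Real.log (localGibbsProfile (fun _ => (1 : ℝ)) (fun _ => (0 : V3)) (fun _ => (1 : ℝ)) y) =
      -(3 / 2 * Real.log (2 * Real.pi)) - ‖y.2‖ ^ 2 / 2 := by
  have h := log_localGibbsProfile_matched (ρ := fun _ : T3 => (1 : ℝ)) (θ := fun _ => (1 : ℝ)) (u := fun _ => (0 : V3))
    (fun _ => (0 : ℝ)) (fun _ => one_pos) (fun _ => one_pos) y
  have he : (fun x : T3 => (fun _ : T3 => (1 : ℝ)) x * Real.exp ((fun _ : ℝ => (0 : ℝ)) ((fun _ : T3 => (1 : ℝ)) x))) =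
      fun _ => (1 : ℝ) := by
    funext x; simp
  simp only [he, Real.log_one, sub_zero, mul_one, add_zero] at h
  rw [h]
  ring

/-- The empirical mean of the log-profile of the standard homogeneous Gibbs law is an affine function of the kinetic
energy: `⟨emp z, log g⟩ = −(3/2) log(2π) − (N+1)⁻¹ E(z)`. [folklore] -/
theorem logProfileMean_one {N : ℕ} (z : Config (N + 1) (Fin 3) T3) :
    ∫ y, Real.log (localGibbsProfile (fun _ => (1 : ℝ)) (fun _ => (0 : V3)) (fun _ => (1 : ℝ)) y)
        ∂(empiricalMeasure z) =
      -(3 / 2 * Real.log (2 * Real.pi)) - ((N + 1 : ℕ) : ℝ)⁻¹ * configEnergy z := by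
  rw [integral_empiricalMeasure]
  simp_rw [log_localGibbsProfile_one]
  rw [Finset.sum_sub_distrib, Finset.sum_const, Finset.card_univ, Fintype.card_fin, nsmul_eq_mul]
  have hE : configEnergy z = 2⁻¹ * ∑ i, ‖(z i).2‖ ^ 2 := rfl
  rw [hE, Finset.mul_sum]
  have hn : ((N + 1 : ℕ) : ℝ) ≠ 0 := by positivity
  have hs : ∑ i, ‖(z i).2‖ ^ 2 / 2 = ∑ i, 2⁻¹ * ‖(z i).2‖ ^ 2 :=
    Finset.sum_congr rfl fun i _ => by ring
  rw [hs]
  field_simp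

/-! ## The abstract chain-rule estimate -/

/-- **Entropy gap against a competitor, abstract form.** `P, ψ, G, μ` probability laws, `G e^{-V} ≤ ψ ≤ G e^{V}` with
`V` measurable and `μ`-integrable, `P ≪ G`, `KL(P ‖ G) < ∞`, `KL(μ ‖ G) ≤ KL(P ‖ G)`; `llr P G = L_P − L_G` `P`-a.s.,
`llr ψ G = L_ψ − L_G` `ψ`-a.s. with `L_P, L_G` `P`-integrable, `L_ψ, L_G` `μ`-integrable and `∫ L_G dμ = ∫ L_G dP`. Then
`0 ≤ KL(P ‖ G) − KL(μ ‖ G) ≤ ∫ L_P dP − ∫ L_ψ dμ` — the upper bound is `KL(μ ‖ ψ) ≥ 0` written through the chain rule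
`KL(μ ‖ ψ) = KL(μ ‖ G) − ∫ llr ψ G dμ` (`toReal_klDiv_eq_of_dominated`). [cite: KipnisLandim1999, App. 1 §8] -/
theorem toReal_klDiv_sub_le_of_dominated {α : Type*} [MeasurableSpace α]
    {P ψ G μ : Measure α} [IsProbabilityMeasure P] [IsProbabilityMeasure ψ] [IsProbabilityMeasure G]
    [IsProbabilityMeasure μ] {V : α → ℝ} (hV : Measurable V) (hVi : Integrable V μ)
    (hlow : G.withDensity (fun x => ENNReal.ofReal (Real.exp (-V x))) ≤ ψ)
    (hup : ψ ≤ G.withDensity (fun x => ENNReal.ofReal (Real.exp (V x))))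
    (hPG : P ≪ G) (hPfin : klDiv P G ≠ ∞) (hKL : klDiv μ G ≤ klDiv P G)
    {LP Lψ LG : α → ℝ} (hllrP : llr P G =ᵐ[P] fun x => LP x - LG x)
    (hllrψ : llr ψ G =ᵐ[ψ] fun x => Lψ x - LG x)
    (hLPi : Integrable LP P) (hLGP : Integrable LG P) (hLψi : Integrable Lψ μ) (hLGμ : Integrable LG μ)
    (hLG : ∫ x, LG x ∂μ = ∫ x, LG x ∂P) :
    0 ≤ (klDiv P G).toReal - (klDiv μ G).toReal ∧
      (klDiv P G).toReal - (klDiv μ G).toReal ≤ ∫ x, LP x ∂P - ∫ x, Lψ x ∂μ := by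
  have hμfin : klDiv μ G ≠ ∞ := ne_top_of_le_ne_top hPfin hKL
  have hμG : μ ≪ G := (klDiv_ne_top_iff.1 hμfin).1
  obtain ⟨hμψ, -, -⟩ := llr_ae_of_dominated hμG hV hlow hup
  obtain ⟨-, hiψ, heq, -⟩ := toReal_klDiv_eq_of_dominated hμG hμfin hV hVi hVi hlow hup
  -- `∫ llr ψ G dμ ≤ KL(μ ‖ G)`
  have h1 : ∫ x, llr ψ G x ∂μ ≤ (klDiv μ G).toReal := by
    have h0 : 0 ≤ (klDiv μ ψ).toReal := ENNReal.toReal_nonneg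
    linarith
  -- `∫ llr ψ G dμ = ∫ L_ψ dμ − ∫ L_G dμ`
  have h2 : ∫ x, llr ψ G x ∂μ = ∫ x, Lψ x ∂μ - ∫ x, LG x ∂μ := by
    rw [integral_congr_ae (hμψ.ae_le hllrψ), integral_sub hLψi hLGμ]
  -- `KL(P ‖ G) = ∫ L_P dP − ∫ L_G dP`
  have h3 : (klDiv P G).toReal = ∫ x, LP x ∂P - ∫ x, LG x ∂P := by
    rw [toReal_klDiv_of_measure_eq hPG (by simp), integral_congr_ae hllrP, integral_sub hLPi hLGP]
  refine ⟨?_, ?_⟩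
  · have := ENNReal.toReal_mono hPfin hKL
    linarith
  · rw [h3]
    linarith

/-! ## The hard-sphere instance -/

/-- **THE ENTROPY GAP AGAINST AN ENERGY-LAW-PRESERVING COMPETITOR** (statics of the registered stub
`stub_staticBookkeeping`). Local Gibbs laws of `N + 1` hard spheres at reduced diameter `σ ≤ 1/2` with continuous
profiles, positive activities and temperatures: `P` (profiles `a, u, θ`, one-body profile `p`), the comparison law `ψ`
(`b, w, ϑ`, profile `q`) and the standard homogeneous Gibbs law `G = localGibbsLaw σ 1 0 1`. If a probability law `μ`
satisfies `KL(μ ‖ G) ≤ KL(P ‖ G)` and has the same law of the kinetic energy as `P`, and the empirical means of `log p`,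
`log q` are `P`-, resp. `μ`-integrable, then
`0 ≤ KL(P ‖ G) − KL(μ ‖ G) ≤ (N+1)(E_P⟨emp, log p⟩ − E_μ⟨emp, log q⟩) − log Z(p) + log Z(q)`.
Proof: `toReal_klDiv_sub_le_of_dominated` with the two-sided energy-tilted domination of `ψ` by `G`
(`exists_localGibbsLaw_dominated`), the explicit log-densities `log(Z⁻¹ 𝟙_D ∏ p) = (N+1)⟨emp, log p⟩ − log Z` on the
hard-sphere domain, and `⟨emp, log g⟩ = −(3/2) log 2π − (N+1)⁻¹ E` (so its `μ`- and `P`-means agree). [cite: Yau1991, §2] -/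
theorem toReal_klDiv_sub_le {a θ b ϑ : T3 → ℝ} {u w : T3 → V3} (ha : Continuous a) (hθ : Continuous θ)
    (hu : Continuous u) (ha0 : ∀ x, 0 < a x) (hθ0 : ∀ x, 0 < θ x) (hb : Continuous b) (hϑ : Continuous ϑ)
    (hw : Continuous w) (hb0 : ∀ x, 0 < b x) (hϑ0 : ∀ x, 0 < ϑ x) {σ : ℝ} (hσ2 : σ ≤ 1 / 2) (N : ℕ)
    (Φ : HardSphereFlow (Torus.geometry (Fin 3)) (hsDiameter σ N) (N + 1))
    (μ : Measure (Config (N + 1) (Fin 3) T3)) [IsProbabilityMeasure μ]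
    (hKL : klDiv μ (localGibbsLaw σ (fun _ => 1) (fun _ => 0) (fun _ => 1) N Φ) ≤
      klDiv (localGibbsLaw σ a u θ N Φ) (localGibbsLaw σ (fun _ => 1) (fun _ => 0) (fun _ => 1) N Φ))
    (hmap : μ.map configEnergy = (localGibbsLaw σ a u θ N Φ).map configEnergy)
    (hintP : Integrable (fun z => ∫ y, Real.log (localGibbsProfile a u θ y) ∂(empiricalMeasure z))
      (localGibbsLaw σ a u θ N Φ))
    (hintμ : Integrable (fun z => ∫ y, Real.log (localGibbsProfile b w ϑ y) ∂(empiricalMeasure z)) μ) :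
    0 ≤ (klDiv (localGibbsLaw σ a u θ N Φ) (localGibbsLaw σ (fun _ => 1) (fun _ => 0) (fun _ => 1) N Φ)).toReal -
        (klDiv μ (localGibbsLaw σ (fun _ => 1) (fun _ => 0) (fun _ => 1) N Φ)).toReal ∧
    (klDiv (localGibbsLaw σ a u θ N Φ) (localGibbsLaw σ (fun _ => 1) (fun _ => 0) (fun _ => 1) N Φ)).toReal -
        (klDiv μ (localGibbsLaw σ (fun _ => 1) (fun _ => 0) (fun _ => 1) N Φ)).toReal ≤
      ((N : ℝ) + 1) * ((∫ z, (∫ y, Real.log (localGibbsProfile a u θ y) ∂(empiricalMeasure z))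
          ∂(localGibbsLaw σ a u θ N Φ)) -
        ∫ z, (∫ y, Real.log (localGibbsProfile b w ϑ y) ∂(empiricalMeasure z)) ∂μ) -
      Real.log (canonicalPartition (Torus.geometry (Fin 3)) (hsDiameter σ N) (N + 1) (localGibbsProfile a u θ)) +
      Real.log (canonicalPartition (Torus.geometry (Fin 3)) (hsDiameter σ N) (N + 1) (localGibbsProfile b w ϑ)) := by
  -- domination data and notation
  obtain ⟨A₁, b₁, -, -, hdomP⟩ := exists_localGibbsLaw_dominated ha hθ hu ha0 hθ0 hσ2
  obtain ⟨hP1, -, hP3, hEiP, -⟩ := hdomP N Φ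
  obtain ⟨A₂, b₂, -, -, hdomψ⟩ := exists_localGibbsLaw_dominated hb hϑ hw hb0 hϑ0 hσ2
  obtain ⟨hψ1, hψ2, -, -, -⟩ := hdomψ N Φ
  set P := localGibbsLaw σ a u θ N Φ with hPdef
  set ψ := localGibbsLaw σ b w ϑ N Φ with hψdef
  set G := localGibbsLaw σ (fun _ => (1 : ℝ)) (fun _ => (0 : V3)) (fun _ => (1 : ℝ)) N Φ with hGdef
  set ZP := canonicalPartition (Torus.geometry (Fin 3)) (hsDiameter σ N) (N + 1) (localGibbsProfile a u θ) with hZP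
  set Zψ := canonicalPartition (Torus.geometry (Fin 3)) (hsDiameter σ N) (N + 1) (localGibbsProfile b w ϑ) with hZψ
  set ZG := canonicalPartition (Torus.geometry (Fin 3)) (hsDiameter σ N) (N + 1)
    (localGibbsProfile (fun _ => (1 : ℝ)) (fun _ => (0 : V3)) (fun _ => (1 : ℝ))) with hZG
  set mP : Config (N + 1) (Fin 3) T3 → ℝ := fun z => ∫ y, Real.log (localGibbsProfile a u θ y) ∂(empiricalMeasure z)
    with hmP
  set mψ : Config (N + 1) (Fin 3) T3 → ℝ := fun z => ∫ y, Real.log (localGibbsProfile b w ϑ y) ∂(empiricalMeasure z)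
    with hmψ
  set mG : Config (N + 1) (Fin 3) T3 → ℝ := fun z =>
    ∫ y, Real.log (localGibbsProfile (fun _ => (1 : ℝ)) (fun _ => (0 : V3)) (fun _ => (1 : ℝ)) y) ∂(empiricalMeasure z)
    with hmG
  haveI hPprob : IsProbabilityMeasure P := isProbabilityMeasure_localGibbsLaw ha hθ hu ha0 hθ0 hσ2 N Φ
  haveI hψprob : IsProbabilityMeasure ψ := isProbabilityMeasure_localGibbsLaw hb hϑ hw hb0 hϑ0 hσ2 N Φ
  haveI hGprob : IsProbabilityMeasure G := isProbabilityMeasure_localGibbsLaw (a₀ := fun _ => (1 : ℝ))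
    (θ₀ := fun _ => (1 : ℝ)) (u₀ := fun _ => (0 : V3)) continuous_const continuous_const continuous_const
    (fun _ => one_pos) (fun _ => one_pos) hσ2 N Φ
  have hN : ((N + 1 : ℕ) : ℝ) = (N : ℝ) + 1 := by push_cast; ring
  have hn0 : N + 1 ≠ 0 := Nat.succ_ne_zero N
  -- positivity of profiles and partition functions
  have hp0 : ∀ y, 0 < localGibbsProfile a u θ y := fun y => mul_pos (ha0 _) (localMaxwellian_pos one_pos (hθ0 _) _ _)
  have hq0 : ∀ y, 0 < localGibbsProfile b w ϑ y := fun y => mul_pos (hb0 _) (localMaxwellian_pos one_pos (hϑ0 _) _ _)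
  have hg0 : ∀ y, 0 < localGibbsProfile (fun _ => (1 : ℝ)) (fun _ => (0 : V3)) (fun _ => (1 : ℝ)) y := fun y =>
    mul_pos one_pos (localMaxwellian_pos one_pos one_pos _ _)
  have hZP0 : 0 < ZP := by
    rw [hZP, canonicalPartition_eq_posPartition ha hθ hu (fun x => (ha0 x).le) hθ0]
    exact posPartition_pos ha ha0 hσ2 N
  have hZψ0 : 0 < Zψ := by
    rw [hZψ, canonicalPartition_eq_posPartition hb hϑ hw (fun x => (hb0 x).le) hϑ0]
    exact posPartition_pos hb hb0 hσ2 N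
  have hZG0 : 0 < ZG := by
    rw [hZG, canonicalPartition_eq_posPartition continuous_const continuous_const continuous_const
      (fun _ => zero_le_one) (fun _ => one_pos)]
    exact posPartition_pos continuous_const (fun _ => one_pos) hσ2 N
  -- absolute continuity and the hard-sphere domain
  set D := hardSphereDomain (Torus.geometry (Fin 3)) (N + 1) (hsDiameter σ N) with hDdef
  set L := liouville (Torus.geometry (Fin 3)) (N + 1) (hsDiameter σ N) with hLdef
  have haeD : ∀ᵐ z ∂L, z ∈ D := by
    rw [hLdef, liouville_eq]
    exact ae_restrict_mem (measurableSet_hardSphereDomain _ Torus.measurable_geometry_sepVec _ _)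
  have hPG : P ≪ G := (Measure.absolutelyContinuous_of_le hP1).trans (withDensity_absolutelyContinuous _ _)
  have hGL : G ≪ L := withDensity_absolutelyContinuous _ _
  have hPL : P ≪ L := withDensity_absolutelyContinuous _ _
  have hψL : ψ ≪ L := withDensity_absolutelyContinuous _ _
  have hPfin : klDiv P G ≠ ∞ := ne_top_of_le_ne_top ENNReal.ofReal_ne_top hP3
  have hμfin : klDiv μ G ≠ ∞ := ne_top_of_le_ne_top hPfin hKL
  have hμG : μ ≪ G := (klDiv_ne_top_iff.1 hμfin).1
  have hμL : μ ≪ L := hμG.trans hGL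
  -- the explicit log-likelihood ratios
  set LP : Config (N + 1) (Fin 3) T3 → ℝ := fun z => ((N : ℝ) + 1) * mP z - Real.log ZP with hLP
  set Lψ : Config (N + 1) (Fin 3) T3 → ℝ := fun z => ((N : ℝ) + 1) * mψ z - Real.log Zψ with hLψ
  set LG : Config (N + 1) (Fin 3) T3 → ℝ := fun z => ((N : ℝ) + 1) * mG z - Real.log ZG with hLG
  have hllrP : llr P G =ᵐ[P] fun z => LP z - LG z := by
    filter_upwards [llr_localGibbsLaw_ae_eq ha hθ hu ha0 hθ0 (b := fun _ => (1 : ℝ)) (ϑ := fun _ => (1 : ℝ))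
      (w := fun _ => (0 : V3)) continuous_const continuous_const continuous_const (fun _ => one_pos)
      (fun _ => one_pos) hσ2 N Φ, hPL.ae_le haeD] with z hz hzD
    rw [hz, log_canonicalDensity_of_mem hn0 hp0 hZP0 hzD, log_canonicalDensity_of_mem hn0 hg0 hZG0 hzD, hN]
  have hllrψ : llr ψ G =ᵐ[ψ] fun z => Lψ z - LG z := by
    filter_upwards [llr_localGibbsLaw_ae_eq hb hϑ hw hb0 hϑ0 (b := fun _ => (1 : ℝ)) (ϑ := fun _ => (1 : ℝ))
      (w := fun _ => (0 : V3)) continuous_const continuous_const continuous_const (fun _ => one_pos)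
      (fun _ => one_pos) hσ2 N Φ, hψL.ae_le haeD] with z hz hzD
    rw [hz, log_canonicalDensity_of_mem hn0 hq0 hZψ0 hzD, log_canonicalDensity_of_mem hn0 hg0 hZG0 hzD, hN]
  -- the `G`-term is an affine function of the energy: integrability and equality of its means
  set c₀ : ℝ := -(3 / 2 * Real.log (2 * Real.pi)) with hc₀
  set FG : ℝ → ℝ := fun e => ((N : ℝ) + 1) * (c₀ - ((N + 1 : ℕ) : ℝ)⁻¹ * e) - Real.log ZG with hFG
  have hFGc : Continuous FG := by fun_prop
  have hLGeq : LG = fun z => FG (configEnergy z) := by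
    funext z
    rw [hLG, hFG, hmG]
    dsimp only
    rw [logProfileMean_one z]
  have hFGP : Integrable (fun z => FG (configEnergy z)) P := by
    have h : (fun z : Config (N + 1) (Fin 3) T3 => FG (configEnergy z)) = fun z => (((N : ℝ) + 1) * c₀ - Real.log ZG) +
        (-(((N : ℝ) + 1) * ((N + 1 : ℕ) : ℝ)⁻¹)) * configEnergy z := by
      funext z; rw [hFG]; ring
    rw [h]
    exact (integrable_const _).add (hEiP.const_mul _)
  obtain ⟨hFGμ, hFGint⟩ := integral_comp_eq_of_map_eq Alexander.measurable_configEnergy hmap hFGc hFGP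
  -- the tilt `V = A₂ (N+1) + b₂ E` is `μ`-integrable (same energy law)
  obtain ⟨hEiμ, -⟩ := integral_comp_eq_of_map_eq Alexander.measurable_configEnergy hmap continuous_id
    (by simpa using hEiP)
  have hVm : Measurable fun z : Config (N + 1) (Fin 3) T3 => A₂ * ((N : ℝ) + 1) + b₂ * configEnergy z :=
    (measurable_const.mul Alexander.measurable_configEnergy).const_add _
  have hVi : Integrable (fun z : Config (N + 1) (Fin 3) T3 => A₂ * ((N : ℝ) + 1) + b₂ * configEnergy z) μ :=
    (integrable_const _).add ((by simpa using hEiμ : Integrable (fun z => configEnergy z) μ).const_mul b₂)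
  -- integrability of `L_P`, `L_ψ`, `L_G`
  have hLPi : Integrable LP P := (hintP.const_mul _).sub (integrable_const _)
  have hLψi : Integrable Lψ μ := (hintμ.const_mul _).sub (integrable_const _)
  have hLGP : Integrable LG P := by rw [hLGeq]; exact hFGP
  have hLGμ : Integrable LG μ := by rw [hLGeq]; exact hFGμ
  have hLGe : ∫ z, LG z ∂μ = ∫ z, LG z ∂P := by rw [hLGeq]; exact hFGint
  obtain ⟨hlo, hhi⟩ := toReal_klDiv_sub_le_of_dominated hVm hVi hψ2 hψ1 hPG hPfin hKL hllrP hllrψ hLPi hLGP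
    hLψi hLGμ hLGe
  refine ⟨hlo, hhi.trans (le_of_eq ?_)⟩
  rw [hLP, hLψ]
  dsimp only
  rw [integral_sub (hintP.const_mul _) (integrable_const _), integral_sub (hintμ.const_mul _) (integrable_const _),
    integral_const_mul, integral_const_mul, integral_const, integral_const]
  simp only [probReal_univ, one_smul]
  ring

/-! ## The thermodynamic identity behind the bookkeeping -/

/-- **Matched log-profile mean minus pressure equals minus the entropy, up to a mass term.** For continuous
`ρ, θ > 0` with packing in the smooth band of `f_ex` and `g(r) = f_ex(rσ³) + rσ³ f_ex′(rσ³)`: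
`∫ρ(log ρ + g(ρ) − 3/2 log(2πθ) − 3/2) − ∫ρ·ρσ³f_ex′(ρσ³) = −∫ρ(3/2 log θ − log ρ − f_ex(ρσ³)) − (3/2 log 2π + 3/2)∫ρ`.
[cite: Yau1991, §2] -/
theorem integral_logProfile_sub_pressure_eq {σ η : ℝ}
    (hfex : ContDiffOn ℝ ((⊤ : ℕ∞) : WithTop ℕ∞) hsExcessFreeEnergy (Ioo 0 η)) (g : ℝ → ℝ)
    (hg : ∀ r, g r = hsExcessFreeEnergy (r * σ ^ 3) + r * σ ^ 3 * deriv hsExcessFreeEnergy (r * σ ^ 3))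
    {ρ θ : T3 → ℝ} (hρc : Continuous ρ) (hθc : Continuous θ) (hρp : ∀ x, 0 < ρ x) (hθp : ∀ x, 0 < θ x)
    (hbs : ∀ x, ρ x * σ ^ 3 ∈ Ioo 0 η) :
    (∫ x, ρ x * (Real.log (ρ x) + g (ρ x) - 3 / 2 * Real.log (2 * Real.pi * θ x) - 3 / 2)) -
        ∫ x, ρ x * (ρ x * σ ^ 3 * deriv hsExcessFreeEnergy (ρ x * σ ^ 3)) =
      -(∫ x, ρ x * (3 / 2 * Real.log (θ x) - Real.log (ρ x) - hsExcessFreeEnergy (ρ x * σ ^ 3))) -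
        (3 / 2 * Real.log (2 * Real.pi) + 3 / 2) * ∫ x, ρ x := by
  -- adapted from `NearConstantShortTimeHL.stub_meansPin`, Step 4
  have hηc : Continuous fun x => ρ x * σ ^ 3 := hρc.mul continuous_const
  have hfc : Continuous fun x => hsExcessFreeEnergy (ρ x * σ ^ 3) := hfex.continuousOn.comp_continuous hηc hbs
  have hf'c : Continuous fun x => deriv hsExcessFreeEnergy (ρ x * σ ^ 3) :=
    (hfex.continuousOn_deriv_of_isOpen isOpen_Ioo (by simp)).comp_continuous hηc hbs
  have hgc : Continuous fun x => g (ρ x) := by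
    simp_rw [hg]; exact hfc.add (hηc.mul hf'c)
  have hlogρ : Continuous fun x => Real.log (ρ x) := hρc.log fun x => (hρp x).ne'
  have hlogθ : Continuous fun x => Real.log (θ x) := hθc.log fun x => (hθp x).ne'
  have hlog2θ : Continuous fun x => Real.log (2 * Real.pi * θ x) :=
    (continuous_const.mul hθc).log fun x => (mul_pos (mul_pos two_pos Real.pi_pos) (hθp x)).ne'
  have hi1 : Integrable (fun x => ρ x * (Real.log (ρ x) + g (ρ x) - 3 / 2 * Real.log (2 * Real.pi * θ x) - 3 / 2)) :=
    integrable_of_continuous_T3 (hρc.mul (((hlogρ.add hgc).sub (continuous_const.mul hlog2θ)).sub continuous_const))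
  have hi2 : Integrable (fun x => ρ x * (ρ x * σ ^ 3 * deriv hsExcessFreeEnergy (ρ x * σ ^ 3))) :=
    integrable_of_continuous_T3 (hρc.mul (hηc.mul hf'c))
  have hi3 : Integrable (fun x => ρ x * (3 / 2 * Real.log (θ x) - Real.log (ρ x) - hsExcessFreeEnergy (ρ x * σ ^ 3))) :=
    integrable_of_continuous_T3 (hρc.mul (((continuous_const.mul hlogθ).sub hlogρ).sub hfc))
  have hi4 : Integrable ρ := integrable_of_continuous_T3 hρc
  have hpt : (fun x => ρ x * (Real.log (ρ x) + g (ρ x) - 3 / 2 * Real.log (2 * Real.pi * θ x) - 3 / 2) -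
      ρ x * (ρ x * σ ^ 3 * deriv hsExcessFreeEnergy (ρ x * σ ^ 3))) =
      fun x => -(ρ x * (3 / 2 * Real.log (θ x) - Real.log (ρ x) - hsExcessFreeEnergy (ρ x * σ ^ 3))) -
        (3 / 2 * Real.log (2 * Real.pi) + 3 / 2) * ρ x := by
    funext x
    have hl : Real.log (2 * Real.pi * θ x) = Real.log (2 * Real.pi) + Real.log (θ x) :=
      Real.log_mul (mul_pos two_pos Real.pi_pos).ne' (hθp x).ne'
    rw [hg, hl]
    ring
  rw [← integral_sub hi1 hi2, hpt, integral_sub hi3.fun_neg (hi4.const_mul _), integral_neg, integral_const_mul]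

end Summit.AtomisticToContinuum.HydrodynamicLimit.Theorems.SwapGapStaticBookkeeping

end
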